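import Literature.MathematicalPhysics.QuantumFieldTheory.Balaban1983to89.B1Eq324BenfattoSect5ChiToOne
import HarnessLib

/-!
# `Balaban1983to89.B1Eq324BenfattoSect5FreeCumulants` — [BenfattoEtAl1978] (2.7) p. 147 and §5 pp. 157–159: the «Leibnitz formula»
# bookkeeping for the MOMENT-DEFINED truncated expectations of the FREE side of the Basic Lemma, and the LOCALISATION IDENTITY of
# the pavement step (p. 159 «Collecting all the errors made in this process (4.7) is proven»), PROVED

statement-level skeleton of published theorems with citation tags; proofs where landed; nothing here is a claim about the
Yang–Mills mass gap

WHY THIS MODULE (cell `pub-ymgap`, seat `dag-n08-b`, node N08 «first missing estimate» lane; companion of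
`B1Eq324BenfattoSect5PerBox`).  The chain is [Balaban1985UV3] (24)/(58) ⇐ [Balaban1982Higgs1] (3.24) ⇐ [BenfattoEtAl1978] Lemma p. 152
(`B1Eq324BenfattoLemma.BasicLemmaPrinted`) ⇐ its §5 proof.  The per-box algebra of §5 (PerBox) runs on the CONDITIONED side, where the
slots `Ψχ_b^□` are bounded and the tree's derivative-defined `B10Eq24Cumulant.truncExp` is the right reading of (2.7).  The target
(4.6)/(4.7), however, displays `exp{Σ_{k=1}^{t} 𝓔̂₀^T(H_J; k)/k!}` for the FREE field `P̂₀` and the POLYNOMIAL `H_J` — unbounded, all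
moments finite — and the typed statement `B1Eq324BenfattoLemma.Ineq46/Ineq47` accordingly uses the MOMENT-DEFINED truncated
expectation `truncatedExp μ H k := cumulantOf (n ↦ ∫ Hⁿ dμ) k` («(2.7) which makes sense in an obvious way if ∫|x_i|^l P(dx) < ∞»).
The free side of the assembly therefore needs the «Leibnitz formula» bookkeeping in MOMENT form (this file's §2, engine: the
moment-hypothesis multilinearity `B1Eq324BenfattoSect5ChiToOne.ursellOf_moment_sum_eq_sum_of_moments`), and ONE more identity that
print leaves to the reader on p. 159 («Now we study the integral and remark that it has the same structure as (5.12) with J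
replaced by Γ̄₁ … choosing a new pavement … Collecting all the errors made in this process (4.7) is proven»): at each pavement step
the exponent extracted in (5.32)/(5.35), `Σ_□ Σ_{k₁>0} (1/(k₁!k₂!)) Ê₀^T(Ψ″₁(□), Ψ′₁(□); k₁, k₂) = Σ_□ [Ê₀^T(Ψ₁(□); k) −
Ê₀^T(Ψ′₁(□); k)]/k!`, must add up, over the `d+1` steps, to `Ê₀^T(H_J; k)/k!` modulo exponentially small cross terms.  §4 is that
step's LOCALISATION IDENTITY: the free cumulant of the full Hamiltonian minus that of the Hamiltonian passed to the next pavement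
equals the sum of the per-box extracted terms PLUS an explicit sum over «cross» colourings, each of which has a deep `Ψ″₁(□)` slot
and a slot outside `□` — the pair Appendix D makes exponentially small under `P̂₀` (not bounded here: the bound is volume-sensitive
and must be summed with the lattice geometry, cf. `abs_sum_cross_le_sum_anchored`).

THE PRINTED TEXT used (verbatim from the page images `bcg_p147.png`, `bcg_p158.png`, `bcg_p159.png`; (5.23)–(5.36) are quoted in
full in `…Sect5JointCumulants` / `…Sect5PerBox`).  p. 147: *"The first is the definition of "cumulants" (or truncated expectations)
of a family of random variables x₁ … x_s with respect to the probability measure P:* `𝓔^T(x₁, …, x_s; k₁, …, k_s) =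
[∂^{k₁+…+k_s}/(∂θ₁^{k₁} … ∂θ_s^{k_s}) log ∫ exp Σ₁ˢ_i θ_i x_i dP]_{θ_i=0}` (2.7) *which makes sense in an obvious way if
∫|x_i|^l P(dx) < ∞, l = 0, 1, …; i = 1, 2, … ."*  p. 158 (5.32): the factor `exp[Σ₁ᵗ_k Σ_{k₁+k₂=k, k₁>0} (1/(k₁!k₂!)) Σ_□
Ê₀^T(Ψ″₁, Ψ′₁; k₁, k₂)]`.  p. 159: *"Now we study the integral and remark that it has the same structure as (5.12) with J replaced
by Γ̄₁ and b by γb. Therefore we can proceed as before choosing a new pavement Q′^b displaced by b²/2 with respect to Q^b obtaining a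
result similar to (5.31) with Γ̄₁ replaced by a new set Γ̄′₁ (much smaller than Γ̄₁). Again one proceeds as before by choosing a
third pavement Q″^b displaced by b²/4 with respect to Q′^b and, if d = 3, a fourth one displaced by b²/16 w.r.t. Q″^b. Collecting
all the errors made in this process (4.7) is proven."*

DICTIONARY.  `𝓔^T(S; k)` (moment-defined) ↦ `LatticeModels.cumulantOf (r ↦ ∫ Sʳ dμ) k` = `B1Eq324BenfattoLemma.truncatedExp μ S k`
(§1: = `LatticeModels.ursellOf (P ↦ ∫ Π_{j∈P} S dμ) univ` on the slots `Fin k`, by `LatticeModels.cumulantOf`'s definition); a joint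
truncated expectation of a colouring `f : Fin k → ι` ↦ `ursellOf (P ↦ ∫ Π_{j∈P} Y_{f(j)} dμ) univ` (as in `…Sect5JointCumulants`,
`…Sect5PerBox`).  The pavement step (§4): palette `Option (M × Bool)` over the finite set `M` of boxes, `Y none = R` (print:
`H_{Γ₁} + Σ_□ Ψ₂(□)` and corrections), `Y (some (m, false)) = B_m = Ψ′₁(□_m)`, `Y (some (m, true)) = A_m = Ψ″₁(□_m)`; «local to
`m`» = all slots in `{B_m, A_m}`; CROSS = uses some `A_m`, local to no box.

WHAT IS PROVED (theorems only; no definition, no named fact, no `sorry`; axioms standard).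
* §1 `cumulantOf_integral_pow_eq_ursellOf`, `truncatedExp_eq_ursellOf_prod` — the moment-defined `𝓔^T(S;k)` IS the Ursell function
  of the product moments on `Fin k` (definitional, `Finset.prod_const`).
* §2 ★ **`cumulantOf_finsetSum_eq_sum_filter_of_moments`** (sub-sum over a sub-palette `S` = sum over the colourings with values in
  `S`, under `AEStronglyMeasurable` + `Integrable |Y_c|^p, p ≤ k`), **`cumulantOf_three_eq_of_moments`** ((5.25)=(5.28)=(5.31)₁ in
  moment form), **`cumulantOf_two_sub_eq_of_moments`** (identifies PerBox's `e₀(k)` with `Ê₀^T(Ψ₁(□);k) − Ê₀^T(Ψ′₁(□);k)`).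
* §3 `abs_integral_prod_le_of_scaled_moments`, **`abs_ursellOf_moment_le_of_scaled_moments`** — the a-priori bound with PER-SLOT
  moment scales `L_j` (the ε-slot form: one small scale makes the joint cumulant small, no sup norm).
* §4 ★★ **`cumulantOf_telescope_eq_sum_local_add_cross`** — the localisation identity of one pavement step (statement above),
  ★ **`abs_sum_cross_le_sum_anchored`** (CROSS ⊆ ⋃_m ANCHORED(m): `|Σ_{CROSS}| ≤ Σ_m Σ_{f uses A_m and leaves □_m} |𝓔^T(Y_f)|` — the
  box-by-box form in which an extensive Appendix-D summation proceeds).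
* §5 `exists_far_pair_of_mem_cross` (the App.-D pair of a cross colouring), **`cumulantOf_add_sub_eq_of_moments`** (two pieces:
  `T(Y₀+Y₁) − T(Y₀) = Σ_{f uses 1}` — removing a small-coefficient correction `H^{(l)}` / `Ψ₃` / the τ-term of (5.34) from a free
  cumulant leaves only colourings with a `Y₁` slot).

HONEST SCOPE / NOT HERE.  (i) GENERIC (finite / probability measure); nothing of print's objects beyond the DICTIONARY.  (ii) NO
analytic bound on the cross or correction colourings is proved here: under `P̂₀` those come from Appendix D (Wick + connected
diagrams + decay: `…AppendixDClustering`/`…AppendixDWick`, the polynomial lift `…Sect5PolyClusters` of the sibling seat) summed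
with the corridor geometry (`…Sect5LegGeometry`) and the boxes line's lattice sums — a uniform count `|palette|^k` would be
volume-dependent and is deliberately NOT offered.  (iii) NOT here: the pavement recursion itself (`…Sect5Pavements`,
`…Translation`), the identification of print's per-step Hamiltonians with the palette pieces ((5.34), boxes line), the
collection of errors into `errTerm`, `b*`.  `BasicLemmaPrinted` stays OPEN.  NOT summit progress; count-neutral for N08; nothing
of [Balaban1985UV3] (41)/(47)/(5) is asserted.
-/

open MeasureTheory ProbabilityTheory Finset
open scoped BigOperators Nat

namespace Literature.MathematicalPhysics.QuantumFieldTheory.Balaban1983to89.B1Eq324BenfattoSect5FreeCumulants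

open _root_.MeasureTheory _root_.ProbabilityTheory
open Literature.Probability.LatticeModels
open Literature.MathematicalPhysics.QuantumFieldTheory.Balaban1983to89.B1Eq324BenfattoSect5JointCumulants
open Literature.MathematicalPhysics.QuantumFieldTheory.Balaban1983to89.B1Eq324BenfattoSect5ChiToOne

/-! ## §1  DICTIONARY: the moment-defined cumulant of one variable is a Ursell function of product moments -/

section Dictionary

variable {Ω : Type*} {mΩ : MeasurableSpace Ω} {μ : Measure Ω}

/-- **(2.7) «which makes sense in an obvious way if `∫|x_i|^l P(dx) < ∞`»** — the `k`-th cumulant of the MOMENT SEQUENCE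
`r ↦ ∫ Sʳ dμ` (`LatticeModels.cumulantOf`, the Möbius form of the moment–cumulant relations; this is how
`B1Eq324BenfattoLemma.truncatedExp` reads (2.7) for unbounded polynomial slots) IS the Ursell function of the product moments
`P ↦ ∫ Π_{j∈P} S dμ` on the `k` slots `Fin k` — `cumulantOf` is by definition that Ursell function of `P ↦ ∫ S^{|P|}`.
[cite: BenfattoEtAl1978, (2.7) p.147] -/
theorem cumulantOf_integral_pow_eq_ursellOf (S : Ω → ℝ) (k : ℕ) :
    cumulantOf (fun r => ∫ ω, S ω ^ r ∂μ) k =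
      ursellOf (fun P : Finset (Fin k) => ∫ ω, ∏ _j ∈ P, S ω ∂μ) univ := by
  unfold cumulantOf
  congr 1
  funext P
  simp only [Finset.prod_const]

/-- The same in the vocabulary of the typed Basic Lemma: `B1Eq324BenfattoLemma.truncatedExp μ H k` (the `𝓔^T(H; k)` of
(4.6)–(4.7), `cumulantOf` of `n ↦ ∫ Hⁿ dμ`) is the Ursell function of `P ↦ ∫ Π_{j∈P} H dμ` on `Fin k`.
[cite: BenfattoEtAl1978, (2.7) p.147 and (4.6) p.152] -/
theorem truncatedExp_eq_ursellOf_prod {d : ℕ} (ν : Measure (B1Eq324BenfattoLemma.Site d → ℝ))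
    (H : (B1Eq324BenfattoLemma.Site d → ℝ) → ℝ) (k : ℕ) :
    B1Eq324BenfattoLemma.truncatedExp ν H k =
      ursellOf (fun P : Finset (Fin k) => ∫ z, ∏ _j ∈ P, H z ∂ν) univ := by
  rw [B1Eq324BenfattoLemma.truncatedExp]
  exact cumulantOf_integral_pow_eq_ursellOf H k

end Dictionary

/-! ## §2  «Leibnitz formula» in MOMENT form: sub-sums expand over the colourings with values in the sub-palette -/

section Leibnitz

variable {Ω : Type*} {mΩ : MeasurableSpace Ω} {μ : Measure Ω} [IsFiniteMeasure μ]
variable {ι : Type*} [Fintype ι] [DecidableEq ι]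

omit [IsFiniteMeasure μ] [DecidableEq ι] in
/-- The colourings of `Fin (n+1)` taking values in a sub-palette `S` are the colourings by `S`. [folklore] -/
private theorem sum_filter_forall_mem_eq' {M : Type*} [AddCommMonoid M] [DecidableEq ι] (S : Finset ι) (n : ℕ)
    (g : (Fin (n + 1) → ι) → M) :
    ∑ f ∈ univ.filter (fun f : Fin (n + 1) → ι => ∀ j, f j ∈ S), g f =
      ∑ f' : Fin (n + 1) → {c // c ∈ S}, g (fun j => (f' j).1) := by
  rw [Finset.sum_subtype (univ.filter (fun f : Fin (n + 1) → ι => ∀ j, f j ∈ S))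
    (p := fun f : Fin (n + 1) → ι => ∀ j, f j ∈ S) (fun f => by simp)]
  exact Fintype.sum_equiv (Equiv.subtypePiEquivPi (α := Fin (n + 1)) (β := fun _ => ι) (p := fun _ c => c ∈ S))
    (fun f : {f : Fin (n + 1) → ι // ∀ j, f j ∈ S} => g f.1) (fun f' => g fun j => (f' j).1) fun _ => rfl

/-- **(2.7)/(5.25) FOR A SUB-SUM, MOMENT FORM**: for a finite family `Y_c` with every absolute moment `∫|Y_c|^p`, `p ≤ n+1`,
integrable (print's polynomial slots under the free field: «makes sense … if ∫|x_i|^l P(dx) < ∞») and a nonempty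
sub-palette `S ⊆ ι`, the `(n+1)`-st moment-cumulant of `Σ_{c∈S} Y_c` is the sum, over the colourings `f : Fin (n+1) → ι`
WITH VALUES IN `S`, of the Ursell functions of the product moments `P ↦ ∫ Π_{j∈P} Y_{f(j)} dμ` — multilinearity
(`B1Eq324BenfattoSect5ChiToOne.ursellOf_moment_sum_eq_sum_of_moments`) for the sub-family, re-indexed.
[cite: BenfattoEtAl1978, (2.7) p.147 and (5.25) p.157] -/
theorem cumulantOf_finsetSum_eq_sum_filter_of_moments {Y : ι → Ω → ℝ} {S : Finset ι} (hS : S.Nonempty)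
    (hYm : ∀ c, AEStronglyMeasurable (Y c) μ) (n : ℕ)
    (hYint : ∀ c (p : ℕ), p ≤ n + 1 → Integrable (fun ω => |Y c ω| ^ p) μ) :
    cumulantOf (fun r => ∫ ω, (∑ c ∈ S, Y c ω) ^ r ∂μ) (n + 1) =
      ∑ f ∈ univ.filter (fun f : Fin (n + 1) → ι => ∀ j, f j ∈ S),
        ursellOf (fun P : Finset (Fin (n + 1)) => ∫ ω, ∏ j ∈ P, Y (f j) ω ∂μ) univ := by
  obtain ⟨c₀, hc₀⟩ := hS
  haveI : Nonempty {c // c ∈ S} := ⟨⟨c₀, hc₀⟩⟩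
  rw [cumulantOf_integral_pow_eq_ursellOf]
  have hfun : (fun P : Finset (Fin (n + 1)) => ∫ ω, ∏ _j ∈ P, (∑ c ∈ S, Y c ω) ∂μ) =
      fun P => ∫ ω, ∏ j ∈ P, (∑ c' : {c // c ∈ S}, (fun (c' : {c // c ∈ S}) (_ : Fin (n + 1)) => Y c'.1) c' j ω) ∂μ := by
    funext P
    refine integral_congr_ae (ae_of_all _ fun ω => Finset.prod_congr rfl fun j _ => ?_)
    exact (Finset.sum_coe_sort S (fun c => Y c ω)).symm
  rw [hfun, ursellOf_moment_sum_eq_sum_of_moments (σ := Fin (n + 1)) (μ := μ)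
    (W := fun (c' : {c // c ∈ S}) (_ : Fin (n + 1)) => Y c'.1) (fun c' _ => hYm c'.1)
    (fun c' _ p hp => hYint c'.1 p (by simpa [Fintype.card_fin] using hp)),
    sum_filter_forall_mem_eq' S n]

/-- Inclusion–exclusion for two properties on a finite sum (copy of the private helper of `…Sect5PerBox`). [folklore] -/
private theorem sum_filter_and_incl_excl' {β : Type*} (s : Finset β) (p q : β → Prop) [DecidablePred p]
    [DecidablePred q] (g : β → ℝ) :
    ∑ x ∈ s.filter (fun x => p x ∧ q x), g x =
      ∑ x ∈ s, g x - ∑ x ∈ s.filter (fun x => ¬p x), g x - ∑ x ∈ s.filter (fun x => ¬q x), g x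
        + ∑ x ∈ s.filter (fun x => ¬p x ∧ ¬q x), g x := by
  have h1 := Finset.sum_filter_add_sum_filter_not s p g
  have h2 := Finset.sum_filter_add_sum_filter_not (s.filter fun x => ¬q x) p g
  have h3 := Finset.sum_filter_add_sum_filter_not (s.filter p) q g
  rw [Finset.filter_filter, Finset.filter_filter] at h2 h3
  have e1 : s.filter (fun x => ¬q x ∧ p x) = s.filter (fun x => p x ∧ ¬q x) :=
    Finset.filter_congr fun x _ => and_comm
  have e2 : s.filter (fun x => ¬q x ∧ ¬p x) = s.filter (fun x => ¬p x ∧ ¬q x) :=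
    Finset.filter_congr fun x _ => and_comm
  rw [e1, e2] at h2
  linarith

omit [Fintype ι] [DecidableEq ι] in
/-- **(5.25) = (5.28) = (5.31)₁ FOR THREE PIECES, MOMENT FORM** (the free-field twin of `…Sect5PerBox.truncExp_three_eq`): for
`Y₀, Y₁, Y₂` with integrable absolute moments of order `≤ n+1`,
`T(Y₀+Y₁+Y₂) = T(Y₀+Y₂) + [T(Y₀+Y₁) − T(Y₀)] + Σ_{f uses 1 and 2} 𝓔^T(Y_f)` at order `n+1`, `T` the moment-cumulant
`cumulantOf (r ↦ ∫(·)ʳdμ) (n+1)`. [cite: BenfattoEtAl1978, (5.25) p.157, (5.28) p.157, (5.31) p.158] -/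
theorem cumulantOf_three_eq_of_moments {Y : Fin 3 → Ω → ℝ} (hYm : ∀ c, AEStronglyMeasurable (Y c) μ) (n : ℕ)
    (hYint : ∀ c (p : ℕ), p ≤ n + 1 → Integrable (fun ω => |Y c ω| ^ p) μ) :
    cumulantOf (fun r => ∫ ω, (Y 0 ω + Y 1 ω + Y 2 ω) ^ r ∂μ) (n + 1) =
      cumulantOf (fun r => ∫ ω, (Y 0 ω + Y 2 ω) ^ r ∂μ) (n + 1)
        + (cumulantOf (fun r => ∫ ω, (Y 0 ω + Y 1 ω) ^ r ∂μ) (n + 1)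
            - cumulantOf (fun r => ∫ ω, (Y 0 ω) ^ r ∂μ) (n + 1))
        + ∑ f ∈ univ.filter (fun f : Fin (n + 1) → Fin 3 => (∃ j, f j = 1) ∧ ∃ j, f j = 2),
            ursellOf (fun P : Finset (Fin (n + 1)) => ∫ ω, ∏ j ∈ P, Y (f j) ω ∂μ) univ := by
  set g : (Fin (n + 1) → Fin 3) → ℝ :=
    fun f => ursellOf (fun P : Finset (Fin (n + 1)) => ∫ ω, ∏ j ∈ P, Y (f j) ω ∂μ) univ with hg
  have m02 : ∀ x : Fin 3, x ∈ ({0, 2} : Finset (Fin 3)) ↔ ¬x = 1 := by decide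
  have m01 : ∀ x : Fin 3, x ∈ ({0, 1} : Finset (Fin 3)) ↔ ¬x = 2 := by decide
  have m0 : ∀ x : Fin 3, x ∈ ({0} : Finset (Fin 3)) ↔ ¬x = 1 ∧ ¬x = 2 := by decide
  have hA : cumulantOf (fun r => ∫ ω, (Y 0 ω + Y 1 ω + Y 2 ω) ^ r ∂μ) (n + 1) = ∑ f, g f := by
    have h := cumulantOf_finsetSum_eq_sum_filter_of_moments (μ := μ) (S := (univ : Finset (Fin 3)))
      Finset.univ_nonempty hYm n hYint
    have hfun : (fun r => ∫ ω, (∑ c ∈ (univ : Finset (Fin 3)), Y c ω) ^ r ∂μ) =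
        fun r => ∫ ω, (Y 0 ω + Y 1 ω + Y 2 ω) ^ r ∂μ := by
      funext r
      simp [Fin.sum_univ_three]
    rw [hfun] at h
    rw [h, Finset.filter_true_of_mem fun f _ j => mem_univ (f j)]
  have hB : cumulantOf (fun r => ∫ ω, (Y 0 ω + Y 2 ω) ^ r ∂μ) (n + 1) =
      ∑ f ∈ univ.filter (fun f : Fin (n + 1) → Fin 3 => ¬∃ j, f j = 1), g f := by
    have h := cumulantOf_finsetSum_eq_sum_filter_of_moments (μ := μ) (S := ({0, 2} : Finset (Fin 3)))
      ⟨0, by simp⟩ hYm n hYint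
    have hfun : (fun r => ∫ ω, (∑ c ∈ ({0, 2} : Finset (Fin 3)), Y c ω) ^ r ∂μ) =
        fun r => ∫ ω, (Y 0 ω + Y 2 ω) ^ r ∂μ := by
      funext r
      simp_rw [Finset.sum_pair (show (0 : Fin 3) ≠ 2 by decide)]
    rw [hfun] at h
    rw [h]
    refine Finset.sum_congr (Finset.filter_congr fun f _ => ?_) fun _ _ => rfl
    simp only [m02, not_exists]
  have hC : cumulantOf (fun r => ∫ ω, (Y 0 ω + Y 1 ω) ^ r ∂μ) (n + 1) =
      ∑ f ∈ univ.filter (fun f : Fin (n + 1) → Fin 3 => ¬∃ j, f j = 2), g f := by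
    have h := cumulantOf_finsetSum_eq_sum_filter_of_moments (μ := μ) (S := ({0, 1} : Finset (Fin 3)))
      ⟨0, by simp⟩ hYm n hYint
    have hfun : (fun r => ∫ ω, (∑ c ∈ ({0, 1} : Finset (Fin 3)), Y c ω) ^ r ∂μ) =
        fun r => ∫ ω, (Y 0 ω + Y 1 ω) ^ r ∂μ := by
      funext r
      simp_rw [Finset.sum_pair (show (0 : Fin 3) ≠ 1 by decide)]
    rw [hfun] at h
    rw [h]
    refine Finset.sum_congr (Finset.filter_congr fun f _ => ?_) fun _ _ => rfl
    simp only [m01, not_exists]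
  have hD : cumulantOf (fun r => ∫ ω, (Y 0 ω) ^ r ∂μ) (n + 1) =
      ∑ f ∈ univ.filter (fun f : Fin (n + 1) → Fin 3 => (¬∃ j, f j = 1) ∧ ¬∃ j, f j = 2), g f := by
    have h := cumulantOf_finsetSum_eq_sum_filter_of_moments (μ := μ) (S := ({0} : Finset (Fin 3)))
      ⟨0, by simp⟩ hYm n hYint
    have hfun : (fun r => ∫ ω, (∑ c ∈ ({0} : Finset (Fin 3)), Y c ω) ^ r ∂μ) =
        fun r => ∫ ω, (Y 0 ω) ^ r ∂μ := by
      funext r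
      simp_rw [Finset.sum_singleton]
    rw [hfun] at h
    rw [h]
    refine Finset.sum_congr (Finset.filter_congr fun f _ => ?_) fun _ _ => rfl
    simp only [m0, forall_and, not_exists]
  have hIE := sum_filter_and_incl_excl' (univ : Finset (Fin (n + 1) → Fin 3)) (fun f => ∃ j, f j = 1)
    (fun f => ∃ j, f j = 2) g
  rw [hA, hB, hC, hD]
  linarith [hIE]

omit [Fintype ι] [DecidableEq ι] in
/-- **(5.31)₁, MOMENT FORM**: `T(Y₀+Y₁) − T(Y₀) = Σ_{f uses 1, avoids 2} 𝓔^T(Y_f)` at order `n+1` — with `Y₀ = Ψ′₁(□)`,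
`Y₁ = Ψ″₁(□)` under `P̂₀` this identifies the number `Σ_{k₁>0} k!/(k₁!k₂!) Ê₀^T(Ψ″₁,Ψ′₁;k₁,k₂)` extracted in (5.32) with
`Ê₀^T(Ψ₁(□); k) − Ê₀^T(Ψ′₁(□); k)` (what `…Sect5PerBox`'s `e₀(k)` IS at instantiation).
[cite: BenfattoEtAl1978, (5.31) p.158 and (5.32) p.158] -/
theorem cumulantOf_two_sub_eq_of_moments {Y : Fin 3 → Ω → ℝ} (hYm : ∀ c, AEStronglyMeasurable (Y c) μ) (n : ℕ)
    (hYint : ∀ c (p : ℕ), p ≤ n + 1 → Integrable (fun ω => |Y c ω| ^ p) μ) :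
    cumulantOf (fun r => ∫ ω, (Y 0 ω + Y 1 ω) ^ r ∂μ) (n + 1) - cumulantOf (fun r => ∫ ω, (Y 0 ω) ^ r ∂μ) (n + 1) =
      ∑ f ∈ univ.filter (fun f : Fin (n + 1) → Fin 3 => (∃ j, f j = 1) ∧ ∀ j, f j ≠ 2),
        ursellOf (fun P : Finset (Fin (n + 1)) => ∫ ω, ∏ j ∈ P, Y (f j) ω ∂μ) univ := by
  set g : (Fin (n + 1) → Fin 3) → ℝ :=
    fun f => ursellOf (fun P : Finset (Fin (n + 1)) => ∫ ω, ∏ j ∈ P, Y (f j) ω ∂μ) univ with hg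
  have m01 : ∀ x : Fin 3, x ∈ ({0, 1} : Finset (Fin 3)) ↔ ¬x = 2 := by decide
  have m0 : ∀ x : Fin 3, x ∈ ({0} : Finset (Fin 3)) ↔ ¬x = 2 ∧ ¬x = 1 := by decide
  have hC : cumulantOf (fun r => ∫ ω, (Y 0 ω + Y 1 ω) ^ r ∂μ) (n + 1) =
      ∑ f ∈ univ.filter (fun f : Fin (n + 1) → Fin 3 => ∀ j, f j ≠ 2), g f := by
    have h := cumulantOf_finsetSum_eq_sum_filter_of_moments (μ := μ) (S := ({0, 1} : Finset (Fin 3)))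
      ⟨0, by simp⟩ hYm n hYint
    have hfun : (fun r => ∫ ω, (∑ c ∈ ({0, 1} : Finset (Fin 3)), Y c ω) ^ r ∂μ) =
        fun r => ∫ ω, (Y 0 ω + Y 1 ω) ^ r ∂μ := by
      funext r
      simp_rw [Finset.sum_pair (show (0 : Fin 3) ≠ 1 by decide)]
    rw [hfun] at h
    rw [h]
    refine Finset.sum_congr (Finset.filter_congr fun f _ => ?_) fun _ _ => rfl
    simp only [m01, ne_eq]
  have hD : cumulantOf (fun r => ∫ ω, (Y 0 ω) ^ r ∂μ) (n + 1) =
      ∑ f ∈ univ.filter (fun f : Fin (n + 1) → Fin 3 => (∀ j, f j ≠ 2) ∧ ¬∃ j, f j = 1), g f := by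
    have h := cumulantOf_finsetSum_eq_sum_filter_of_moments (μ := μ) (S := ({0} : Finset (Fin 3)))
      ⟨0, by simp⟩ hYm n hYint
    have hfun : (fun r => ∫ ω, (∑ c ∈ ({0} : Finset (Fin 3)), Y c ω) ^ r ∂μ) =
        fun r => ∫ ω, (Y 0 ω) ^ r ∂μ := by
      funext r
      simp_rw [Finset.sum_singleton]
    rw [hfun] at h
    rw [h]
    refine Finset.sum_congr (Finset.filter_congr fun f _ => ?_) fun _ _ => rfl
    simp only [m0, forall_and, not_exists, ne_eq]
  have h2 := Finset.sum_filter_add_sum_filter_not (univ.filter fun f : Fin (n + 1) → Fin 3 => ∀ j, f j ≠ 2)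
    (fun f => ∃ j, f j = 1) g
  rw [Finset.filter_filter, Finset.filter_filter] at h2
  have e1 : univ.filter (fun f : Fin (n + 1) → Fin 3 => (∀ j, f j ≠ 2) ∧ ∃ j, f j = 1) =
      univ.filter (fun f : Fin (n + 1) → Fin 3 => (∃ j, f j = 1) ∧ ∀ j, f j ≠ 2) :=
    Finset.filter_congr fun x _ => and_comm
  rw [e1] at h2
  rw [hC, hD]
  linarith [h2]

end Leibnitz

/-! ## §3  A-priori bounds with PER-SLOT moment scales (the ε-slot form without sup norms) -/

section Scaled

variable {Ω : Type*} {mΩ : MeasurableSpace Ω} {μ : Measure Ω} [IsProbabilityMeasure μ]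
variable {σ : Type*}

/-- **A joint moment with per-slot scales**: if `∫|Z_j|^{|P|} dμ ≤ L_j^{|P|}` with `L_j > 0` for `j ∈ P` (probability measure),
then `|∫ Π_{j∈P} Z_j dμ| ≤ Π_{j∈P} L_j` — `B1Eq324BenfattoSect5ChiToOne.abs_integral_prod_le_of_moments` for the normalised
slots `Z_j/L_j`; a slot with a small scale `L_j = ε` (print's `Ψ₃ = H′^{(l)}`, the (5.34) corrections, «far» monomials)
makes the whole moment small without any sup bound. [cite: BenfattoEtAl1978, (5.26) p.157 and Appendix D p.165] -/
theorem abs_integral_prod_le_of_scaled_moments {Z : σ → Ω → ℝ} {L : σ → ℝ} (P : Finset σ)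
    (hZm : ∀ j ∈ P, AEStronglyMeasurable (Z j) μ) (hZint : ∀ j ∈ P, Integrable (fun ω => |Z j ω| ^ P.card) μ)
    (hL : ∀ j ∈ P, 0 < L j) (hZL : ∀ j ∈ P, ∫ ω, |Z j ω| ^ P.card ∂μ ≤ L j ^ P.card) :
    |∫ ω, ∏ j ∈ P, Z j ω ∂μ| ≤ ∏ j ∈ P, L j := by
  have hprod : (fun ω => ∏ j ∈ P, Z j ω) = fun ω => (∏ j ∈ P, L j) * ∏ j ∈ P, (Z j ω / L j) := by
    funext ω
    rw [← Finset.prod_mul_distrib]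
    exact Finset.prod_congr rfl fun j hj => (mul_div_cancel₀ (Z j ω) (hL j hj).ne').symm
  have hL0 : 0 ≤ ∏ j ∈ P, L j := Finset.prod_nonneg fun j hj => (hL j hj).le
  have h1 : |∫ ω, ∏ j ∈ P, (Z j ω / L j) ∂μ| ≤ 1 ^ P.card := by
    refine abs_integral_prod_le_of_moments (μ := μ) (Z := fun j ω => Z j ω / L j) (L := 1) P
      (fun j hj => by simpa only [div_eq_mul_inv] using (hZm j hj).mul_const ((L j)⁻¹))
      (fun j hj => ?_) (fun j hj => ?_)
    · have h := (hZint j hj).div_const (L j ^ P.card)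
      refine h.congr (ae_of_all _ fun ω => ?_)
      simp only [abs_div, abs_of_pos (hL j hj), div_pow]
    · have hLp : 0 < L j ^ P.card := pow_pos (hL j hj) _
      have heq : (fun ω => |Z j ω / L j| ^ P.card) = fun ω => |Z j ω| ^ P.card / L j ^ P.card := by
        funext ω
        rw [abs_div, abs_of_pos (hL j hj), div_pow]
      rw [heq, integral_div, one_pow, div_le_one hLp]
      exact hZL j hj
  rw [one_pow] at h1
  rw [hprod, integral_const_mul, abs_mul, abs_of_nonneg hL0]
  exact (mul_le_mul_of_nonneg_left h1 hL0).trans_eq (mul_one _)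

/-- **THE A-PRIORI BOUND WITH PER-SLOT SCALES**: for slots `Z_j`, `j ∈ V` (nonempty), with `∫|Z_j|^p ≤ L_j^p` for all
`p ≤ |V|` and `L_j > 0`, the Ursell function of the product moments obeys `|𝓔^T(Z_j, j∈V)| ≤ (Σ_{π∈𝒫(V)}(|π|−1)!)·Π_{j∈V} L_j`
(`B1Eq324BenfattoSect5JointCumulants.abs_ursellOf_le` with the weights `L_j`). [cite: BenfattoEtAl1978, (5.26) p.157] -/
theorem abs_ursellOf_moment_le_of_scaled_moments [DecidableEq σ] {Z : σ → Ω → ℝ} {L : σ → ℝ} {V : Finset σ}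
    (hV : V.Nonempty) (hZm : ∀ j ∈ V, AEStronglyMeasurable (Z j) μ)
    (hZint : ∀ j ∈ V, ∀ p : ℕ, p ≤ V.card → Integrable (fun ω => |Z j ω| ^ p) μ)
    (hL : ∀ j ∈ V, 0 < L j) (hZL : ∀ j ∈ V, ∀ p : ℕ, p ≤ V.card → ∫ ω, |Z j ω| ^ p ∂μ ≤ L j ^ p) :
    |ursellOf (fun P : Finset σ => ∫ ω, ∏ j ∈ P, Z j ω ∂μ) V| ≤
      (∑ π ∈ setPartitions V, ((π.card - 1)! : ℝ)) * ∏ j ∈ V, L j :=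
  abs_ursellOf_le _ (by simp) hV L fun P hP =>
    abs_integral_prod_le_of_scaled_moments P (fun j hj => hZm j (hP hj))
      (fun j hj => hZint j (hP hj) _ (Finset.card_le_card hP)) (fun j hj => hL j (hP hj))
      (fun j hj => hZL j (hP hj) _ (Finset.card_le_card hP))

end Scaled

/-! ## §4  THE LOCALISATION IDENTITY of the pavement step (p. 159): extracted per-box terms versus the cross terms -/

section Telescope

variable {Ω : Type*} {mΩ : MeasurableSpace Ω} {μ : Measure Ω} [IsFiniteMeasure μ]
variable {M : Type*} [Fintype M] [DecidableEq M]

/-- Sums over a union of index sets are at most the sum of the sums (nonnegative terms). [folklore] -/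
private theorem sum_biUnion_le_sum_sum {α β : Type*} [DecidableEq β] (T : Finset α) (B : α → Finset β) (W : β → ℝ)
    (hW : ∀ b, 0 ≤ W b) : ∑ b ∈ T.biUnion B, W b ≤ ∑ a ∈ T, ∑ b ∈ B a, W b := by
  classical
  induction T using Finset.induction_on with
  | empty => simp
  | insert a T ha ih =>
    rw [Finset.biUnion_insert, Finset.sum_insert ha]
    have hu : ∑ b ∈ B a ∪ T.biUnion B, W b ≤ ∑ b ∈ B a, W b + ∑ b ∈ T.biUnion B, W b := by
      rw [← Finset.sum_union_inter]
      have : 0 ≤ ∑ b ∈ B a ∩ T.biUnion B, W b := Finset.sum_nonneg fun b _ => hW b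
      linarith
    linarith

/-- **THE LOCALISATION IDENTITY OF ONE PAVEMENT STEP** (what «Collecting all the errors made in this process (4.7) is proven»,
p. 159, asks of the free cumulants).  Palette `Option (M × Bool)` over a finite set `M` of boxes: `Y none = R` (the rest:
print's `H_{Γ₁} + Σ_□Ψ₂(□)`), `Y (some (m,false)) = B_m` (print's `Ψ′₁(□_m)`), `Y (some (m,true)) = A_m` (print's `Ψ″₁(□_m)`,
the piece with a leg deep inside `□′_m`).  For slots with integrable absolute moments of order `≤ n+1`, at order `n+1`:
`T(R + Σ_m B_m + Σ_m A_m) − T(R + Σ_m B_m) − Σ_m [T(B_m + A_m) − T(B_m)] = Σ_{f ∈ CROSS} 𝓔^T(Y_f)`,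
where `T` is the moment-cumulant `cumulantOf (r ↦ ∫(·)ʳ dμ) (n+1)`, the bracket `Σ_m[…]` is the exponent
`Σ_□ Σ_{k₁>0} k!/(k₁!k₂!) Ê₀^T(Ψ″₁,Ψ′₁;k₁,k₂)` extracted in (5.32)/(5.35) (`cumulantOf_two_sub_eq_of_moments`), and `CROSS` is the
set of colourings of the `n+1` slots that USE some deep colour `A_m` and are NOT local to a single box (not all slots in
`{B_m, A_m}`) — each of them has one slot coloured `A_m` and another coloured outside `□_m`, the configuration Appendix D makes
exponentially small under `P̂₀`.  Pure bookkeeping: all colourings = (no `A`) ⊔ (⊔_m local to `m` using `A_m`) ⊔ CROSS.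
[cite: BenfattoEtAl1978, (5.31)–(5.32) p.158 and p.159] -/
theorem cumulantOf_telescope_eq_sum_local_add_cross {Y : Option (M × Bool) → Ω → ℝ}
    (hYm : ∀ c, AEStronglyMeasurable (Y c) μ) (n : ℕ)
    (hYint : ∀ c (p : ℕ), p ≤ n + 1 → Integrable (fun ω => |Y c ω| ^ p) μ) :
    cumulantOf (fun r => ∫ ω, (∑ c, Y c ω) ^ r ∂μ) (n + 1)
      - cumulantOf (fun r => ∫ ω, (Y none ω + ∑ m, Y (some (m, false)) ω) ^ r ∂μ) (n + 1)
      - ∑ m, (cumulantOf (fun r => ∫ ω, (Y (some (m, false)) ω + Y (some (m, true)) ω) ^ r ∂μ) (n + 1)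
          - cumulantOf (fun r => ∫ ω, (Y (some (m, false)) ω) ^ r ∂μ) (n + 1)) =
      ∑ f ∈ univ.filter (fun f : Fin (n + 1) → Option (M × Bool) =>
          (∃ j m, f j = some (m, true)) ∧ ¬∃ m, ∀ j, f j = some (m, false) ∨ f j = some (m, true)),
        ursellOf (fun P : Finset (Fin (n + 1)) => ∫ ω, ∏ j ∈ P, Y (f j) ω ∂μ) univ := by
  classical
  set g : (Fin (n + 1) → Option (M × Bool)) → ℝ :=
    fun f => ursellOf (fun P : Finset (Fin (n + 1)) => ∫ ω, ∏ j ∈ P, Y (f j) ω ∂μ) univ with hg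
  -- the four kinds of cumulants as filtered colouring sums
  have hAll : cumulantOf (fun r => ∫ ω, (∑ c, Y c ω) ^ r ∂μ) (n + 1) = ∑ f, g f := by
    have h := cumulantOf_finsetSum_eq_sum_filter_of_moments (μ := μ) (S := (univ : Finset (Option (M × Bool))))
      ⟨none, mem_univ _⟩ hYm n hYint
    rw [h, Finset.filter_true_of_mem fun f _ j => mem_univ (f j)]
  -- the «rest ∪ boundary» sub-palette
  set S₀ : Finset (Option (M × Bool)) := insert none ((univ : Finset M).map
    ⟨fun m => some (m, false), fun m m' h => by simpa using h⟩) with hS₀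
  have hmemS₀ : ∀ c : Option (M × Bool), c ∈ S₀ ↔ ∀ m, c ≠ some (m, true) := by
    intro c
    rcases c with _ | ⟨m', b⟩
    · simp [hS₀]
    · cases b
      · simp [hS₀]
      · simp [hS₀]
  have hsumS₀ : (fun r => ∫ ω, (∑ c ∈ S₀, Y c ω) ^ r ∂μ) =
      fun r => ∫ ω, (Y none ω + ∑ m, Y (some (m, false)) ω) ^ r ∂μ := by
    funext r
    refine integral_congr_ae (ae_of_all _ fun ω => ?_)
    have hnot : none ∉ (univ : Finset M).map ⟨fun m => some (m, false), fun m m' h => by simpa using h⟩ := by simp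
    simp only [hS₀, Finset.sum_insert hnot, Finset.sum_map, Function.Embedding.coeFn_mk]
  have hNoA : cumulantOf (fun r => ∫ ω, (Y none ω + ∑ m, Y (some (m, false)) ω) ^ r ∂μ) (n + 1) =
      ∑ f ∈ univ.filter (fun f : Fin (n + 1) → Option (M × Bool) => ¬∃ j m, f j = some (m, true)), g f := by
    have h := cumulantOf_finsetSum_eq_sum_filter_of_moments (μ := μ) (S := S₀) ⟨none, by simp [hS₀]⟩ hYm n hYint
    rw [hsumS₀] at h
    rw [h]
    refine Finset.sum_congr (Finset.filter_congr fun f _ => ?_) fun _ _ => rfl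
    simp only [hmemS₀, ne_eq, not_exists]
  have hPair : ∀ m : M, cumulantOf (fun r => ∫ ω, (Y (some (m, false)) ω + Y (some (m, true)) ω) ^ r ∂μ) (n + 1) =
      ∑ f ∈ univ.filter (fun f : Fin (n + 1) → Option (M × Bool) =>
        ∀ j, f j = some (m, false) ∨ f j = some (m, true)), g f := by
    intro m
    have hne : (some (m, false) : Option (M × Bool)) ≠ some (m, true) := by simp
    have h := cumulantOf_finsetSum_eq_sum_filter_of_moments (μ := μ)
      (S := ({some (m, false), some (m, true)} : Finset (Option (M × Bool)))) ⟨some (m, false), by simp⟩ hYm n hYint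
    have hfun : (fun r => ∫ ω, (∑ c ∈ ({some (m, false), some (m, true)} : Finset (Option (M × Bool))), Y c ω) ^ r ∂μ) =
        fun r => ∫ ω, (Y (some (m, false)) ω + Y (some (m, true)) ω) ^ r ∂μ := by
      funext r
      simp_rw [Finset.sum_pair hne]
    rw [hfun] at h
    rw [h]
    refine Finset.sum_congr (Finset.filter_congr fun f _ => ?_) fun _ _ => rfl
    simp only [Finset.mem_insert, Finset.mem_singleton]
  have hSingle : ∀ m : M, cumulantOf (fun r => ∫ ω, (Y (some (m, false)) ω) ^ r ∂μ) (n + 1) =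
      ∑ f ∈ univ.filter (fun f : Fin (n + 1) → Option (M × Bool) => ∀ j, f j = some (m, false)), g f := by
    intro m
    have h := cumulantOf_finsetSum_eq_sum_filter_of_moments (μ := μ)
      (S := ({some (m, false)} : Finset (Option (M × Bool)))) ⟨some (m, false), by simp⟩ hYm n hYint
    have hfun : (fun r => ∫ ω, (∑ c ∈ ({some (m, false)} : Finset (Option (M × Bool))), Y c ω) ^ r ∂μ) =
        fun r => ∫ ω, (Y (some (m, false)) ω) ^ r ∂μ := by
      funext r
      simp_rw [Finset.sum_singleton]
    rw [hfun] at h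
    rw [h]
    refine Finset.sum_congr (Finset.filter_congr fun f _ => ?_) fun _ _ => rfl
    simp only [Finset.mem_singleton]
  -- combinatorics of the colourings
  have hsplit1 := Finset.sum_filter_add_sum_filter_not (univ : Finset (Fin (n + 1) → Option (M × Bool)))
    (fun f => ∃ j m, f j = some (m, true)) g
  have hsplit2 := Finset.sum_filter_add_sum_filter_not
    ((univ : Finset (Fin (n + 1) → Option (M × Bool))).filter (fun f => ∃ j m, f j = some (m, true)))
    (fun f => ∃ m, ∀ j, f j = some (m, false) ∨ f j = some (m, true)) g
  rw [Finset.filter_filter, Finset.filter_filter] at hsplit2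
  -- the local colourings using a deep colour, box by box
  have hbiU : (univ : Finset (Fin (n + 1) → Option (M × Bool))).filter
      (fun f => (∃ j m, f j = some (m, true)) ∧ ∃ m, ∀ j, f j = some (m, false) ∨ f j = some (m, true)) =
      (univ : Finset M).biUnion (fun m => univ.filter (fun f : Fin (n + 1) → Option (M × Bool) =>
        (∀ j, f j = some (m, false) ∨ f j = some (m, true)) ∧ ∃ j, f j = some (m, true))) := by
    ext f
    simp only [Finset.mem_filter, Finset.mem_univ, true_and, Finset.mem_biUnion]
    constructor
    · rintro ⟨⟨j₀, m₀, hj₀⟩, ⟨m₁, hloc⟩⟩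
      have hm : m₀ = m₁ := by
        rcases hloc j₀ with h | h
        · rw [hj₀] at h
          simp at h
        · rw [hj₀] at h
          simpa using h
      subst hm
      exact ⟨m₀, hloc, j₀, hj₀⟩
    · rintro ⟨m, hloc, j, hj⟩
      exact ⟨⟨j, m, hj⟩, m, hloc⟩
  have hdisj : Set.PairwiseDisjoint (↑(univ : Finset M))
      (fun m => univ.filter (fun f : Fin (n + 1) → Option (M × Bool) =>
        (∀ j, f j = some (m, false) ∨ f j = some (m, true)) ∧ ∃ j, f j = some (m, true))) := by
    intro m _ m' _ hmm'
    rw [Function.onFun, Finset.disjoint_filter]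
    intro f _ hf hf'
    apply hmm'
    have key : ∀ {b b' : Bool}, (some (m, b) : Option (M × Bool)) = some (m', b') → m = m' :=
      fun h => (Prod.mk.inj (Option.some.inj h)).1
    rcases hf.1 0 with h | h <;> rcases hf'.1 0 with h' | h' <;> exact key (h.symm.trans h')
  have hlocal : ∀ m : M, ∑ f ∈ univ.filter (fun f : Fin (n + 1) → Option (M × Bool) =>
        (∀ j, f j = some (m, false) ∨ f j = some (m, true)) ∧ ∃ j, f j = some (m, true)), g f =
      (∑ f ∈ univ.filter (fun f : Fin (n + 1) → Option (M × Bool) =>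
          ∀ j, f j = some (m, false) ∨ f j = some (m, true)), g f)
        - ∑ f ∈ univ.filter (fun f : Fin (n + 1) → Option (M × Bool) => ∀ j, f j = some (m, false)), g f := by
    intro m
    have h := Finset.sum_filter_add_sum_filter_not
      ((univ : Finset (Fin (n + 1) → Option (M × Bool))).filter
        (fun f => ∀ j, f j = some (m, false) ∨ f j = some (m, true)))
      (fun f => ∃ j, f j = some (m, true)) g
    rw [Finset.filter_filter, Finset.filter_filter] at h
    have honly : univ.filter (fun f : Fin (n + 1) → Option (M × Bool) =>
        (∀ j, f j = some (m, false) ∨ f j = some (m, true)) ∧ ¬∃ j, f j = some (m, true)) =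
        univ.filter (fun f : Fin (n + 1) → Option (M × Bool) => ∀ j, f j = some (m, false)) := by
      refine Finset.filter_congr fun f _ => ⟨fun ⟨hloc, hno⟩ j => ?_, fun hB => ⟨fun j => Or.inl (hB j), ?_⟩⟩
      · rcases hloc j with h | h
        · exact h
        · exact absurd ⟨j, h⟩ hno
      · rintro ⟨j, hj⟩
        have := hB j
        rw [hj] at this
        simp at this
    rw [honly] at h
    linarith
  have hboxes : ∑ m, (cumulantOf (fun r => ∫ ω, (Y (some (m, false)) ω + Y (some (m, true)) ω) ^ r ∂μ) (n + 1)
      - cumulantOf (fun r => ∫ ω, (Y (some (m, false)) ω) ^ r ∂μ) (n + 1)) =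
      ∑ m, ∑ f ∈ univ.filter (fun f : Fin (n + 1) → Option (M × Bool) =>
        (∀ j, f j = some (m, false) ∨ f j = some (m, true)) ∧ ∃ j, f j = some (m, true)), g f :=
    Finset.sum_congr rfl fun m _ => by rw [hPair m, hSingle m, hlocal m]
  rw [hAll, hNoA, hboxes, ← Finset.sum_biUnion hdisj, ← hbiU]
  linarith [hsplit1, hsplit2]

/-- **CROSS ⊆ ⋃_m ANCHORED(m)**: every cross colouring has, for some box `m`, a slot coloured `A_m` AND a slot coloured outside
`{B_m, A_m}`; hence for any nonnegative weights the cross sum is at most the sum over boxes of the anchored sums — the form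
in which Appendix D's decay (between `□′_m∖Γ₄(□_m)` and the outside of `□_m`) is summed box by box, extensively.
[cite: BenfattoEtAl1978, p.159 and Appendix D p.165] -/
theorem abs_sum_cross_le_sum_anchored (n : ℕ) (g : (Fin (n + 1) → Option (M × Bool)) → ℝ) :
    |∑ f ∈ univ.filter (fun f : Fin (n + 1) → Option (M × Bool) =>
          (∃ j m, f j = some (m, true)) ∧ ¬∃ m, ∀ j, f j = some (m, false) ∨ f j = some (m, true)), g f| ≤
      ∑ m, ∑ f ∈ univ.filter (fun f : Fin (n + 1) → Option (M × Bool) =>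
          (∃ j, f j = some (m, true)) ∧ ∃ j, ¬(f j = some (m, false) ∨ f j = some (m, true))), |g f| := by
  classical
  refine (Finset.abs_sum_le_sum_abs _ _).trans ?_
  have hsub : univ.filter (fun f : Fin (n + 1) → Option (M × Bool) =>
        (∃ j m, f j = some (m, true)) ∧ ¬∃ m, ∀ j, f j = some (m, false) ∨ f j = some (m, true)) ⊆
      (univ : Finset M).biUnion (fun m => univ.filter (fun f : Fin (n + 1) → Option (M × Bool) =>
        (∃ j, f j = some (m, true)) ∧ ∃ j, ¬(f j = some (m, false) ∨ f j = some (m, true)))) := by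
    intro f hf
    simp only [Finset.mem_filter, Finset.mem_univ, true_and, Finset.mem_biUnion] at hf ⊢
    obtain ⟨⟨j₀, m₀, hj₀⟩, hnl⟩ := hf
    refine ⟨m₀, ⟨j₀, hj₀⟩, ?_⟩
    by_contra hall
    exact hnl ⟨m₀, fun j => by_contra fun hj => hall ⟨j, hj⟩⟩
  exact (Finset.sum_le_sum_of_subset_of_nonneg hsub fun f _ _ => abs_nonneg _).trans
    (sum_biUnion_le_sum_sum _ _ _ fun f => abs_nonneg _)

end Telescope

/-! ## §5  Consumer-facing forms: the far pair of a cross colouring; two pieces -/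

section Consumer

variable {Ω : Type*} {mΩ : MeasurableSpace Ω} {μ : Measure Ω} [IsFiniteMeasure μ]
variable {M : Type*} [Fintype M] [DecidableEq M]

/-- **Every cross colouring carries the Appendix-D pair**: a slot coloured by a deep piece `A_m` and a slot coloured outside
`{B_m, A_m}` (the rest `R`, or a piece of ANOTHER box) — legs at distance `≥ b^{3/2}/2` in print's geometry
(`□′_m∖Γ₄(□_m)` versus the complement of `□′_m`). [cite: BenfattoEtAl1978, p.159 and Appendix D p.165] -/
theorem exists_far_pair_of_mem_cross {n : ℕ} {f : Fin (n + 1) → Option (M × Bool)}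
    (hf : f ∈ univ.filter (fun f : Fin (n + 1) → Option (M × Bool) =>
      (∃ j m, f j = some (m, true)) ∧ ¬∃ m, ∀ j, f j = some (m, false) ∨ f j = some (m, true))) :
    ∃ m j j', f j = some (m, true) ∧ ¬(f j' = some (m, false) ∨ f j' = some (m, true)) := by
  obtain ⟨⟨j₀, m₀, hj₀⟩, hnl⟩ := (Finset.mem_filter.1 hf).2
  by_contra hall
  refine hnl ⟨m₀, fun j => ?_⟩
  by_contra hj
  exact hall ⟨m₀, j₀, j, hj₀, hj⟩

omit [Fintype M] [DecidableEq M] in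
/-- **TWO PIECES, MOMENT FORM** — `T(Y₀ + Y₁) − T(Y₀) = Σ_{f uses 1} 𝓔^T(Y_f)` at order `n+1` (colourings `Fin (n+1) → Fin 2`):
the shape in which a SMALL-COEFFICIENT correction `Y₁` (print's `H^{(l)}` of (5.11), `Ψ₃ = H′^{(l)}` of (5.24), the `τ`-term of
(5.34)) is removed from a free cumulant — every surviving colouring carries at least one `Y₁` slot.
[cite: BenfattoEtAl1978, (5.11) p.155, (5.24) p.157, (5.34) p.159] -/
theorem cumulantOf_add_sub_eq_of_moments {Y : Fin 2 → Ω → ℝ} (hYm : ∀ c, AEStronglyMeasurable (Y c) μ) (n : ℕ)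
    (hYint : ∀ c (p : ℕ), p ≤ n + 1 → Integrable (fun ω => |Y c ω| ^ p) μ) :
    cumulantOf (fun r => ∫ ω, (Y 0 ω + Y 1 ω) ^ r ∂μ) (n + 1) - cumulantOf (fun r => ∫ ω, (Y 0 ω) ^ r ∂μ) (n + 1) =
      ∑ f ∈ univ.filter (fun f : Fin (n + 1) → Fin 2 => ∃ j, f j = 1),
        ursellOf (fun P : Finset (Fin (n + 1)) => ∫ ω, ∏ j ∈ P, Y (f j) ω ∂μ) univ := by
  set g : (Fin (n + 1) → Fin 2) → ℝ :=
    fun f => ursellOf (fun P : Finset (Fin (n + 1)) => ∫ ω, ∏ j ∈ P, Y (f j) ω ∂μ) univ with hg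
  have hA : cumulantOf (fun r => ∫ ω, (Y 0 ω + Y 1 ω) ^ r ∂μ) (n + 1) = ∑ f, g f := by
    have h := cumulantOf_finsetSum_eq_sum_filter_of_moments (μ := μ) (S := (univ : Finset (Fin 2)))
      Finset.univ_nonempty hYm n hYint
    have hfun : (fun r => ∫ ω, (∑ c ∈ (univ : Finset (Fin 2)), Y c ω) ^ r ∂μ) =
        fun r => ∫ ω, (Y 0 ω + Y 1 ω) ^ r ∂μ := by
      funext r
      simp [Fin.sum_univ_two]
    rw [hfun] at h
    rw [h, Finset.filter_true_of_mem fun f _ j => mem_univ (f j)]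
  have m0 : ∀ x : Fin 2, x ∈ ({0} : Finset (Fin 2)) ↔ ¬x = 1 := by decide
  have hD : cumulantOf (fun r => ∫ ω, (Y 0 ω) ^ r ∂μ) (n + 1) =
      ∑ f ∈ univ.filter (fun f : Fin (n + 1) → Fin 2 => ¬∃ j, f j = 1), g f := by
    have h := cumulantOf_finsetSum_eq_sum_filter_of_moments (μ := μ) (S := ({0} : Finset (Fin 2)))
      ⟨0, by simp⟩ hYm n hYint
    have hfun : (fun r => ∫ ω, (∑ c ∈ ({0} : Finset (Fin 2)), Y c ω) ^ r ∂μ) = fun r => ∫ ω, (Y 0 ω) ^ r ∂μ := by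
      funext r
      simp_rw [Finset.sum_singleton]
    rw [hfun] at h
    rw [h]
    refine Finset.sum_congr (Finset.filter_congr fun f _ => ?_) fun _ _ => rfl
    simp only [m0, not_exists]
  have h2 := Finset.sum_filter_add_sum_filter_not (univ : Finset (Fin (n + 1) → Fin 2)) (fun f => ∃ j, f j = 1) g
  rw [hA, hD]
  linarith [h2]

end Consumer

end Literature.MathematicalPhysics.QuantumFieldTheory.Balaban1983to89.B1Eq324BenfattoSect5FreeCumulants
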